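import Summits.AnomalousDissipation.AnomalousDissipation.Theorems.SolenoidalFractalHomogenisationLagrangianStepZ7GlueEulerian
import Summits.AnomalousDissipation.AnomalousDissipation.Theorems.SolenoidalFractalHomogenisationLagrangianStepZ7GlueBookkeeping
import Summits.AnomalousDissipation.AnomalousDissipation.Theorems.SolenoidalFractalHomogenisationLagrangianStepZ7GlueTemplate
import HarnessLib

/-!
# K1L_D (stmt-AnomalousDissipation-27980), §9z GLUE v2 PROVED: `cellInputs_BIL_of : (V ⇒ V_modEC) → cellInputs_alphaBeta_text → §9z (BIL)`
# (helper; `--supports … --as helper`; lead-k1l-onelevel-p1 g5; text of record `Lines/onelevel_Z7_glue.lean` v2 6afd2a85caf7, BLESSED D26-15)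

The reduction of the bilinear window bound §9z of `stub_cellInputs` (= the hypothesis of the landed `cellInputs_of_bilinear`, p680253, VERBATIM)
to the two registry-level inputs of memo L12: (H1) the capped modulated cell clause `CellClauseMod.SlowVectorClauseModEC` relative to (V)
(future stub `stub_Vmod_of_V`) and (H2) the αβ text `Z7Glue.cellInputs_alphaBeta_text` (frame conjugacy on the two refresh pieces + the three
Eulerian coarse facts (N1)(N1*)(N2); future stub `stub_Z7_alphaBeta`).  Assembly of `…Z7GlueEulerian` (step (a), per piece), `…Z7GlueCompose`
(steps (b)(c), Eulerian two-piece composition), `…Z7GlueBookkeeping` (step (d)) and `…Z7GlueTemplate` (template facts).  Constants: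
`θ₀ := min θ₀' (θ₁/Cα)`, `Λ₀ := max Λ₀' (max 16 (⌈ϱ/ϱ₁⌉₊ + 1))`, `σz := min σ ½ / 16`, `Cz := CN·Cη·(√(2Cmono) + √2·Cη + 1) + 1`,
`Cη = Cm(Cm·cA + 1)`, `cA = 1 + 2^σ + (Cαθ₀)^σ + ϱ^σ`.
NOT a proof of (H1), of (H2), of `stub_cellInputs`, of the crux, or of AD; rung F-D1.A0.
-/

set_option linter.dupNamespace false  -- the summit-side namespace `Summit.AnomalousDissipation.AnomalousDissipation.…` repeats a component by design (D-0017)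

noncomputable section

namespace Summit.AnomalousDissipation.AnomalousDissipation.Theorems.SolenoidalFractalHomogenisation.LagrangianStep.Z7Glue

open Literature.Analysis Literature.Analysis.FluidPDE Literature.Analysis.FunctionSpaces
open MeasureTheory Set Filter UnitAddTorus
open scoped ENNReal NNReal InnerProductSpace
open Literature.Analysis.FluidPDE.LatticeShear (LagrangianLatticeCarrier LatticeWord)
open Summit.AnomalousDissipation.AnomalousDissipation.Theorems.SolenoidalFractalHomogenisation.LagrangianStep.CellClauseMod
open Summit.AnomalousDissipation.AnomalousDissipation.Theorems.SolenoidalFractalHomogenisation.LagrangianRenormalisationStep (cellVisc_pos')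

set_option maxHeartbeats 1600000 in
/-- **THE GLUE v2.**  `(V) ⇒ (V_modEC)` (own constant `Cm ≥ C`, ranges `θ₁, ϱ₁`) and the αβ facts imply the bilinear window bound §9z of
`stub_cellInputs` (text verbatim).  See the module docstring and memo L12 §3. -/
theorem cellInputs_BIL_of :
    (∀ k (W : LatticeWord k) (M : ℝ) (hM : 0 < M) (c : ℝ), 0 < c →
      ∀ (Φ : ℝ → Torus.Visc4 (Fin 3) → Torus.Visc4 (Fin 3)) (lo hi Λ β σ C ν₀ K : ℝ),
        SlowVectorClauseF W M hM c Φ lo hi Λ β σ C ν₀ K →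
        ∃ θ₁ > (0:ℝ), ∃ ϱ₁ > (0:ℝ), ∃ Cm : ℝ, C ≤ Cm ∧ SlowVectorClauseModEC W M hM c Φ lo hi Λ β σ Cm ν₀ K θ₁ ϱ₁) →
    cellInputs_alphaBeta_text →
 ∀ k (W : Literature.Analysis.FluidPDE.LatticeShear.LatticeWord k) (M : ℝ) (hM : 0 < M) (c : ℝ), 0 < c →
    ∀ (Φ : ℝ → Torus.Visc4 (Fin 3) → Torus.Visc4 (Fin 3)) (lo hi Λ β σ C ν₀ K Cf νf Kf : ℝ),
      0 < lo → lo ≤ 1 → 1 ≤ hi → 1 < Λ → 0 ≤ β →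
      0 < σ → 0 ≤ C → 0 < ν₀ → 0 < K → SlowVectorClauseF W M hM c Φ lo hi Λ β σ C ν₀ K →
      0 ≤ Cf → 0 < νf → 0 < Kf → CellEnergyClausesW W M hM c lo hi Λ β Cf νf Kf →
      (∀ Kb : ℝ, 1 ≤ Kb → ∃ CK : ℝ, 1 ≤ CK ∧ ∃ cK > (0:ℝ), ∃ νh > (0:ℝ), HighLabelDecayW W M hM lo hi Λ β νh Kb CK cK) →
      ∃ ν₁ > (0:ℝ), ∃ K₁ > (0:ℝ), ∃ Λ₀ : ℕ, ∃ θ₀ > (0:ℝ), ∃ Cz > (0:ℝ), ∃ σz > (0:ℝ),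
        ∀ E : Literature.Analysis.FluidPDE.LatticeShear.LagrangianLatticeCarrier k, E.design = W.stretch M hM → E.gain = c → E.nu0 ≤ ν₁ → K₁ ≤ E.K →
          E.LPermissible → E.Regular → (∀ m, Λ₀ * E.N m ≤ E.N (m + 1)) → (∀ m, E.N m ^ 2 ≤ E.N (m + 1)) →
          (∀ m, E.cellVisc (m + 1) * ((E.N (m + 1) : ℝ) / E.N m) ^ (1 / 4 : ℝ) ≤ 1) →
          (∀ m, E.K * ((E.N (m + 1) : ℝ) / E.N m) ^ (1 / 4 : ℝ) ≤ ((E.N (m + 1) : ℝ) / E.N m) * E.cellVisc (m + 1)) →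
          (∀ m, E.θ (m + 1) * ((E.N (m + 1) : ℝ) / E.N m) ^ (1 / 16 : ℝ) ≤ θ₀) →
          (∀ m, ((E.N (m + 1) : ℝ) / E.N m) ^ (1 / 16 : ℝ) * E.physPeriod (m + 1) ≤ E.refresh (m + 1)) →
        ∃ mstar : ℕ, ∀ m, mstar ≤ m →
          ∀ Lc : ℕ, Lc = ⌊((E.N m : ℝ) / E.N (m + 1)) ^ (1 / 64 : ℝ) * (E.N (m + 1) * E.cellVisc (m + 1)) / Real.sqrt c⌋₊ →
          ∀ S : Torus.Visc4 (Fin 3), Torus.OddSmall S β → Torus.NearIso S lo hi →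
            Torus.OddSmall (Φ (E.cellVisc (m + 1)) S) β → Torus.NearIso (Φ (E.cellVisc (m + 1)) S) lo hi →
          ∀ Um Um1 : ℝ → ℝ → (V2 →L[ℝ] V2),
            Torus.IsPropagator 1 (E.partialSum m) (E.kbar m • renormStep (Φ (E.cellVisc (m + 1))) (E.gain / E.cellVisc (m + 1) ^ 2) S) Um →
            Torus.IsPropagator 1 (E.partialSum (m + 1)) (E.kbar (m + 1) • S) Um1 →
          ∀ ηz ε : ℝ, ηz = Cz * ((E.N m : ℝ) / E.N (m + 1)) ^ σz →
            ε = ((E.N m : ℝ) / E.N (m + 1)) ^ σz * (1 - Real.exp (-(4 * Real.pi ^ 2 * (E.kbar m * lo)))) * E.refresh (m + 1) →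
          ∀ S : Finset (Fin 3 → ℤ), S = (Torus.freqBall (Lc / 2)).erase 0 →
          ∀ (j : ℕ) (s' : ℝ), (j : ℝ) * E.refresh (m + 1) + E.refresh (m + 1) ≤ s' →
            s' ≤ (j : ℝ) * E.refresh (m + 1) + 2 * E.refresh (m + 1) → s' ≤ 1 →
            ∀ x y : V2,
              |⟪Um1 ((j : ℝ) * E.refresh (m + 1)) s' x - Um ((j : ℝ) * E.refresh (m + 1)) s' x, y⟫_ℝ| ≤ ηz
                * Real.sqrt (∑ k' ∈ S, min 1 ((E.a (m + 1) * (8 * Real.pi ^ 2 * ‖Torus.latticeVec k'‖ ^ 2 * lo * (E.cellVisc (m + 1) + c / E.cellVisc (m + 1)) / (E.N (m + 1) : ℝ) ^ 2)) * (s' - (j : ℝ) * E.refresh (m + 1))) * ‖UnitAddTorus.mFourierCoeff (EuclideanSpace.complexify ∘ ⇑(x)) k'‖ ^ 2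
                      + (‖x‖ ^ 2 - ∑ k' ∈ S, ‖UnitAddTorus.mFourierCoeff (EuclideanSpace.complexify ∘ ⇑(x)) k'‖ ^ 2))
                * Real.sqrt (∑ k' ∈ S, min 1 ((E.a (m + 1) * (8 * Real.pi ^ 2 * ‖Torus.latticeVec k'‖ ^ 2 * lo * (E.cellVisc (m + 1) + c / E.cellVisc (m + 1)) / (E.N (m + 1) : ℝ) ^ 2)) * (s' - (j : ℝ) * E.refresh (m + 1))) * ‖UnitAddTorus.mFourierCoeff (EuclideanSpace.complexify ∘ ⇑(y)) k'‖ ^ 2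
                      + (‖y‖ ^ 2 - ∑ k' ∈ S, ‖UnitAddTorus.mFourierCoeff (EuclideanSpace.complexify ∘ ⇑(y)) k'‖ ^ 2)) := by
  intro H1 H2 k W M hM c hc Φ lo hi Λ β σ C ν₀ K Cf νf Kf hlo hlo1 hhi hΛ hβ hσ hC hν₀ hK hV hCf hνf hKf hF hH
  obtain ⟨θ₁, hθ₁, ϱ₁, hϱ₁, Cm, hCCm, hMod⟩ := H1 k W M hM c hc Φ lo hi Λ β σ C ν₀ K hV
  obtain ⟨ν₁', hν₁', K₁', hK₁', Λ₀', θ₀', hθ₀', Cα, hCα, ϱ, hϱ, CN, hCN, Cmono, hCmono, hE⟩ :=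
    H2 k W M hM c hc Φ lo hi Λ β σ C ν₀ K Cf νf Kf hlo hlo1 hhi hΛ hβ hσ hC hν₀ hK hV hCf hνf hKf hF hH
  -- constants
  have hCm : 0 ≤ Cm := hC.trans hCCm
  set θ₀ : ℝ := min θ₀' (θ₁ / Cα) with hθ₀_def
  have hθ₀ : 0 < θ₀ := lt_min hθ₀' (div_pos hθ₁ hCα)
  set cA : ℝ := 1 + (2:ℝ) ^ σ + (Cα * θ₀) ^ σ + ϱ ^ σ with hcA_def
  have hcA : 0 ≤ cA := by
    have h1 : 0 ≤ (2:ℝ) ^ σ := Real.rpow_nonneg (by norm_num) σ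
    have h2 : 0 ≤ (Cα * θ₀) ^ σ := Real.rpow_nonneg (by positivity) σ
    have h3 : 0 ≤ ϱ ^ σ := Real.rpow_nonneg hϱ.le σ
    rw [hcA_def]; linarith only [h1, h2, h3]
  set Cη : ℝ := Cm * (Cm * cA + 1) with hCη_def
  have hCη : 0 ≤ Cη := by rw [hCη_def]; positivity
  set Cz : ℝ := CN * Cη * (Real.sqrt (2 * Cmono) + Real.sqrt 2 * Cη + 1) + 1 with hCz_def
  have hCz : 0 < Cz := by rw [hCz_def]; positivity
  set σz : ℝ := min σ (1 / 2) / 16 with hσz_def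
  have hσz : 0 < σz := (sigmaz_facts hσ).1
  set Λ₀ : ℕ := max Λ₀' (max 16 (⌈ϱ / ϱ₁⌉₊ + 1)) with hΛ₀_def
  refine ⟨min ν₁' ν₀, lt_min hν₁' hν₀, max K₁' K, lt_max_of_lt_left hK₁', Λ₀, θ₀, hθ₀, Cz, hCz, σz, hσz, ?_⟩
  intro E hdes hgain hnu0 hKE hLP hReg hT1 hN2 hT2 hT3 hT4 hT5
  have hT1' : ∀ m, Λ₀' * E.N m ≤ E.N (m + 1) := fun m =>
    le_trans (Nat.mul_le_mul_right _ (le_max_left _ _)) (hT1 m)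
  have hT4' : ∀ m, E.θ (m + 1) * ((E.N (m + 1) : ℝ) / E.N m) ^ (1 / 16 : ℝ) ≤ θ₀' := fun m => (hT4 m).trans (min_le_left _ _)
  obtain ⟨mstar, hm⟩ := hE E hdes hgain (hnu0.trans (min_le_left _ _)) ((le_max_left _ _).trans hKE) hLP hReg hT1' hN2 hT2 hT3 hT4' hT5
  refine ⟨mstar, fun m hmm => ?_⟩
  intro Lc hLc S hSo hSn hΦSo hΦSn Um Um1 hUm hUm1 ηz ε hηz hε Sf hSf j s' h1 h2 h3 x y
  obtain ⟨hFC1, hFC2, hN1, hN1s, hN2'⟩ := hm m hmm Lc hLc S hSo hSn hΦSo hΦSn Um Um1 hUm hUm1 Sf hSf j s' h1 h2 h3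
  -- the level's numbers
  set ν : ℝ := E.cellVisc (m + 1) with hν_def
  set R : ℝ := E.refresh (m + 1) with hR_def
  set ρ : ℝ := (E.N m : ℝ) / E.N (m + 1) with hρ_def
  set r₁ : ℝ := ((j : ℝ) + 1) * E.refresh (m + 1) with hr₁_def
  set sj : ℝ := (j : ℝ) * E.refresh (m + 1) with hsj_def
  have hν : 0 < ν := cellVisc_pos' E.toFractalCarrierData (m + 1)
  have ha : 0 < E.a (m + 1) := E.a_pos (m + 1)
  have hN : (0:ℝ) < E.N (m + 1) := by exact_mod_cast E.N_pos (m + 1)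
  have hNm : (0:ℝ) < E.N m := by exact_mod_cast E.N_pos m
  obtain ⟨hρ0, hρ1, hρΛ⟩ := rho_facts E m (hT1 m) (hN2 m)
  have hR : 0 < R := E.refresh_pos (m + 1)
  have hr₁ : r₁ = sj + R := by rw [hr₁_def, hsj_def, hR_def]; ring
  have hsj0 : 0 ≤ sj := by rw [hsj_def]; positivity
  have hsjr₁ : sj < r₁ := by rw [hr₁]; linarith only [hR]
  have hr₁s' : r₁ ≤ s' := by rw [hr₁]; exact h1
  have hs'R : s' - r₁ ≤ R := by rw [hr₁]; linarith only [h2]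
  -- the separation constant: `ρ ≤ 1/16`, `ϱ ρ ≤ ϱ₁`-type facts
  have hΛ₀16 : (16:ℝ) ≤ (Λ₀ : ℝ) := by
    have : (16:ℕ) ≤ Λ₀ := (le_max_left _ _).trans (le_max_right _ _)
    exact_mod_cast this
  have hΛ₀ϱ : ϱ / ϱ₁ ≤ (Λ₀ : ℝ) := by
    have h1 : ϱ / ϱ₁ ≤ (⌈ϱ / ϱ₁⌉₊ : ℝ) := Nat.le_ceil _
    have h2 : ((⌈ϱ / ϱ₁⌉₊ + 1 : ℕ) : ℝ) ≤ (Λ₀ : ℝ) := by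
      have : ⌈ϱ / ϱ₁⌉₊ + 1 ≤ Λ₀ := (le_max_right _ _).trans (le_max_right _ _)
      exact_mod_cast this
    push_cast at h2; linarith only [h1, h2]
  have hΛ₀pos : (0:ℝ) < Λ₀ := by linarith only [hΛ₀16]
  have hρ16 : ρ ≤ 1 / 16 := by
    rw [le_div_iff₀ (by norm_num : (0:ℝ) < 16)]
    calc ρ * 16 ≤ ρ * Λ₀ := mul_le_mul_of_nonneg_left hΛ₀16 hρ0.le
      _ ≤ 1 := hρΛ
  -- side conditions of the clause
  have hνν₀ : ν < ν₀ := lt_of_lt_of_le (hLP.permissible.2.2.2.2.1 (m + 1) (by omega)) (hnu0.trans (min_le_right _ _))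
  have hKE' : K ≤ E.K := (le_max_right _ _).trans hKE
  obtain ⟨hKn, hqρ⟩ := ceil_facts E m hK.le hKE' hρ16 (hT3 m)
  obtain ⟨hθρ, hθθ₀⟩ := theta_facts E m (hN2 m) (hT4 m)
  have hθθ₁ : Cα * E.θ (m + 1) ≤ θ₁ := by
    have h1 : E.θ (m + 1) ≤ θ₁ / Cα := hθθ₀.trans (min_le_right _ _)
    calc Cα * E.θ (m + 1) ≤ Cα * (θ₁ / Cα) := mul_le_mul_of_nonneg_left h1 hCα.le
      _ = θ₁ := by field_simp
  have hϱϱ₁ : ϱ * E.N m ≤ ϱ₁ * E.N (m + 1) := by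
    -- `ϱ ≤ ϱ₁ Λ₀` and `Λ₀ N m ≤ N (m+1)`
    have h1 : ϱ ≤ ϱ₁ * Λ₀ := by rw [div_le_iff₀ hϱ₁] at hΛ₀ϱ; linarith only [hΛ₀ϱ]
    have h2 : ((Λ₀ : ℕ) : ℝ) * (E.N m : ℝ) ≤ (E.N (m + 1) : ℝ) := by exact_mod_cast hT1 m
    calc ϱ * E.N m ≤ (ϱ₁ * Λ₀) * E.N m := mul_le_mul_of_nonneg_right h1 hNm.le
      _ = ϱ₁ * ((Λ₀ : ℝ) * E.N m) := by ring
      _ ≤ ϱ₁ * E.N (m + 1) := mul_le_mul_of_nonneg_left h2 hϱ₁.le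
  -- bookkeeping inputs
  have hνρ : ν ≤ ρ ^ (1 / 4 : ℝ) := nu_le_rpow E m (hT2 m)
  have hθρ' : Cα * E.θ (m + 1) ≤ Cα * θ₀ * ρ ^ (1 / 16 : ℝ) := by
    have h1 : E.θ (m + 1) ≤ θ₀ * ρ ^ (1 / 16 : ℝ) := by
      have := (theta_facts E m (hN2 m) (hT4 m)).1; exact this
    calc Cα * E.θ (m + 1) ≤ Cα * (θ₀ * ρ ^ (1 / 16 : ℝ)) := mul_le_mul_of_nonneg_left h1 hCα.le
      _ = Cα * θ₀ * ρ ^ (1 / 16 : ℝ) := by ring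
  have hrρ : ϱ * E.N m / E.N (m + 1) ≤ ϱ * ρ := by rw [hρ_def, mul_div_assoc]
  have hA : ν ^ σ + ((⌈K / ν⌉₊ : ℝ) / E.N (m + 1)) ^ σ + (Cα * E.θ (m + 1)) ^ σ + (ϱ * E.N m / E.N (m + 1)) ^ σ ≤ cA * ρ ^ σz :=
    smallTerms_le hσ hρ0 hρ1 hν.le (by positivity) (by have := E.θ_pos (m + 1); positivity) (by positivity) hCα.le hθ₀.le hϱ.le
      hνρ hqρ hθρ' hrρ
  obtain ⟨hP1eq, hPR, hP0⟩ := period_facts E m hdes (hT5 m) (r₁ - sj)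
  have hρz0 : 0 ≤ ρ ^ σz := Real.rpow_nonneg hρ0.le σz
  have hρz1 : ρ ^ σz ≤ 1 := Real.rpow_le_one hρ0.le hρ1 hσz.le
  -- piece 1: `[sj, r₁]`
  have hP1 := eulerian_piece hMod hFC1 hUm hUm1 hsjr₁ hσ hCm hΛ.le hϱ.le hνν₀ hKn hθθ₁ hϱϱ₁ hSo hSn
  have hw1 : (M * W.period / ν) / (E.a (m + 1) * (r₁ - sj)) = E.physPeriod (m + 1) / R := by
    rw [hP1eq, hr₁]; ring_nf
  rw [hw1] at hP1
  have hT1le : (min 1 (E.physPeriod (m + 1) / R)) ^ σ ≤ ρ ^ σz :=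
    transient_full_le hσ hρ0 hρ1 (div_nonneg hP0.le hR.le) (by rw [div_le_iff₀ hR]; exact hPR)
  have hη₁le : Cm * (Cm * (ν ^ σ + ((⌈K / ν⌉₊ : ℝ) / E.N (m + 1)) ^ σ + (Cα * E.θ (m + 1)) ^ σ + (ϱ * E.N m / E.N (m + 1)) ^ σ)
      + (min 1 (E.physPeriod (m + 1) / R)) ^ σ) ≤ Cη * ρ ^ σz := eta_full_le hCm hA hT1le
  have hη₁0 : 0 ≤ Cm * (Cm * (ν ^ σ + ((⌈K / ν⌉₊ : ℝ) / E.N (m + 1)) ^ σ + (Cα * E.θ (m + 1)) ^ σ + (ϱ * E.N m / E.N (m + 1)) ^ σ)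
      + (min 1 (E.physPeriod (m + 1) / R)) ^ σ) := by
    have h1 : 0 ≤ ν ^ σ := Real.rpow_nonneg hν.le σ
    have h2 : 0 ≤ ((⌈K / ν⌉₊ : ℝ) / E.N (m + 1)) ^ σ := Real.rpow_nonneg (by positivity) σ
    have h3 : 0 ≤ (Cα * E.θ (m + 1)) ^ σ := Real.rpow_nonneg (by have := E.θ_pos (m + 1); positivity) σ
    have h4 : 0 ≤ (ϱ * E.N m / E.N (m + 1)) ^ σ := Real.rpow_nonneg (by positivity) σ
    have h5 : 0 ≤ (min 1 (E.physPeriod (m + 1) / R)) ^ σ := Real.rpow_nonneg (le_min zero_le_one (div_nonneg hP0.le hR.le)) σ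
    have : 0 ≤ Cm * (ν ^ σ + ((⌈K / ν⌉₊ : ℝ) / E.N (m + 1)) ^ σ + (Cα * E.θ (m + 1)) ^ σ + (ϱ * E.N m / E.N (m + 1)) ^ σ) :=
      mul_nonneg hCm (by linarith only [h1, h2, h3, h4])
    exact mul_nonneg hCm (by linarith only [this, h5])
  -- the N-currency data
  set X2 : ℝ := ∑ k' ∈ Sf, min 1 ((E.a (m + 1) * (8 * Real.pi ^ 2 * ‖Torus.latticeVec k'‖ ^ 2 * lo * (E.cellVisc (m + 1) + c / E.cellVisc (m + 1)) / (E.N (m + 1) : ℝ) ^ 2)) * (s' - (j : ℝ) * E.refresh (m + 1))) * ‖UnitAddTorus.mFourierCoeff (EuclideanSpace.complexify ∘ ⇑(x)) k'‖ ^ 2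
      + (‖x‖ ^ 2 - ∑ k' ∈ Sf, ‖UnitAddTorus.mFourierCoeff (EuclideanSpace.complexify ∘ ⇑(x)) k'‖ ^ 2) with hX2
  set Y2 : ℝ := ∑ k' ∈ Sf, min 1 ((E.a (m + 1) * (8 * Real.pi ^ 2 * ‖Torus.latticeVec k'‖ ^ 2 * lo * (E.cellVisc (m + 1) + c / E.cellVisc (m + 1)) / (E.N (m + 1) : ℝ) ^ 2)) * (s' - (j : ℝ) * E.refresh (m + 1))) * ‖UnitAddTorus.mFourierCoeff (EuclideanSpace.complexify ∘ ⇑(y)) k'‖ ^ 2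
      + (‖y‖ ^ 2 - ∑ k' ∈ Sf, ‖UnitAddTorus.mFourierCoeff (EuclideanSpace.complexify ∘ ⇑(y)) k'‖ ^ 2) with hY2
  have hCηCz : CN * Cη ≤ Cz := by
    have : 0 ≤ CN * Cη * (Real.sqrt (2 * Cmono) + Real.sqrt 2 * Cη) := by positivity
    have e : Cz = CN * Cη + (CN * Cη * (Real.sqrt (2 * Cmono) + Real.sqrt 2 * Cη) + 1) := by rw [hCz_def]; ring
    rw [e]; linarith only [this]
  -- case split on the post-refresh piece
  rcases hr₁s'.eq_or_lt with hEq | hLt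
  · -- `s' = r₁`: one piece only
    have hb := hP1 x y
    rw [hEq] at hb
    have hs1 : Real.sqrt (lossFwd (Um sj s') x) ≤ Real.sqrt CN * Real.sqrt X2 := by
      rw [← Real.sqrt_mul hCN.le]; exact Real.sqrt_le_sqrt (hN1 x)
    have hs2 : Real.sqrt (lossAdj (Um sj s') y) ≤ Real.sqrt CN * Real.sqrt Y2 := by
      rw [← Real.sqrt_mul hCN.le]; exact Real.sqrt_le_sqrt (hN1s y)
    have hCNsq : Real.sqrt CN * Real.sqrt CN = CN := Real.mul_self_sqrt hCN.le
    calc |⟪Um1 sj s' x - Um sj s' x, y⟫_ℝ|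
        ≤ (Cη * ρ ^ σz) * (Real.sqrt CN * Real.sqrt X2) * (Real.sqrt CN * Real.sqrt Y2) :=
          hb.trans (mul_le_mul (mul_le_mul hη₁le hs1 (Real.sqrt_nonneg _) (mul_nonneg hCη hρz0)) hs2 (Real.sqrt_nonneg _)
            (mul_nonneg (mul_nonneg hCη hρz0) (by positivity)))
      _ = (Cη * ρ ^ σz) * (Real.sqrt CN * Real.sqrt CN) * Real.sqrt X2 * Real.sqrt Y2 := by ring
      _ = (CN * Cη) * ρ ^ σz * Real.sqrt X2 * Real.sqrt Y2 := by rw [hCNsq]; ring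
      _ ≤ Cz * ρ ^ σz * Real.sqrt X2 * Real.sqrt Y2 := by gcongr
      _ = ηz * Real.sqrt X2 * Real.sqrt Y2 := by rw [hηz]
  · -- `r₁ < s'`: two pieces
    have hP2 := eulerian_piece hMod (hFC2 hLt) hUm hUm1 hLt hσ hCm hΛ.le hϱ.le hνν₀ hKn hθθ₁ hϱϱ₁ hSo hSn
    obtain ⟨hP2eq, -, -⟩ := period_facts E m hdes (hT5 m) (s' - r₁)
    rw [hP2eq] at hP2
    have hτ0 : 0 < s' - r₁ := by linarith only [hLt]
    have hv1 : (s' - r₁) / R ≤ 1 := (div_le_one hR).2 hs'R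
    have hT2le : (min 1 (E.physPeriod (m + 1) / (s' - r₁))) ^ σ * Real.sqrt ((s' - r₁) / R) ≤ ρ ^ σz :=
      transient_short_mul_sqrt_le hσ hρ0 hP0.le hR hτ0 hs'R hPR
    have hη₂le : Cm * (Cm * (ν ^ σ + ((⌈K / ν⌉₊ : ℝ) / E.N (m + 1)) ^ σ + (Cα * E.θ (m + 1)) ^ σ + (ϱ * E.N m / E.N (m + 1)) ^ σ)
        + (min 1 (E.physPeriod (m + 1) / (s' - r₁))) ^ σ) ≤ Cη :=
      eta_short_le hCm hcA hσ (div_nonneg hP0.le hτ0.le) hA hρz1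
    have hη₂sq : Cm * (Cm * (ν ^ σ + ((⌈K / ν⌉₊ : ℝ) / E.N (m + 1)) ^ σ + (Cα * E.θ (m + 1)) ^ σ + (ϱ * E.N m / E.N (m + 1)) ^ σ)
        + (min 1 (E.physPeriod (m + 1) / (s' - r₁))) ^ σ) * Real.sqrt ((s' - r₁) / R) ≤ Cη * ρ ^ σz :=
      eta_short_mul_sqrt_le hCm hcA hρz0 hv1 hA hT2le
    have hη₂0 : 0 ≤ Cm * (Cm * (ν ^ σ + ((⌈K / ν⌉₊ : ℝ) / E.N (m + 1)) ^ σ + (Cα * E.θ (m + 1)) ^ σ + (ϱ * E.N m / E.N (m + 1)) ^ σ)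
        + (min 1 (E.physPeriod (m + 1) / (s' - r₁))) ^ σ) := by
      have h1 : 0 ≤ ν ^ σ := Real.rpow_nonneg hν.le σ
      have h2 : 0 ≤ ((⌈K / ν⌉₊ : ℝ) / E.N (m + 1)) ^ σ := Real.rpow_nonneg (by positivity) σ
      have h3 : 0 ≤ (Cα * E.θ (m + 1)) ^ σ := Real.rpow_nonneg (by have := E.θ_pos (m + 1); positivity) σ
      have h4 : 0 ≤ (ϱ * E.N m / E.N (m + 1)) ^ σ := Real.rpow_nonneg (by positivity) σ
      have h5 : 0 ≤ (min 1 (E.physPeriod (m + 1) / (s' - r₁))) ^ σ :=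
        Real.rpow_nonneg (le_min zero_le_one (div_nonneg hP0.le hτ0.le)) σ
      have : 0 ≤ Cm * (ν ^ σ + ((⌈K / ν⌉₊ : ℝ) / E.N (m + 1)) ^ σ + (Cα * E.θ (m + 1)) ^ σ + (ϱ * E.N m / E.N (m + 1)) ^ σ) :=
        mul_nonneg hCm (by linarith only [h1, h2, h3, h4])
      exact mul_nonneg hCm (by linarith only [this, h5])
    have hcomp := eulerian_compose hUm hUm1 hsj0 hsjr₁.le hLt.le h3 hη₁0 hη₂0 hCN.le hCmono.le (div_nonneg hτ0.le hR.le)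
      hP1 hP2 x y (hN1 x) (hN1s y) (hN2' x)
    have hglue := glueConstant_le hη₁0 hCη hCN.le hCmono.le hη₁le hη₂le hη₂sq
    have hXY : 0 ≤ Real.sqrt X2 * Real.sqrt Y2 := by positivity
    have hDle : CN * Cη * (Real.sqrt (2 * Cmono) + Real.sqrt 2 * Cη + 1) * ρ ^ σz ≤ Cz * ρ ^ σz := by
      have hle : CN * Cη * (Real.sqrt (2 * Cmono) + Real.sqrt 2 * Cη + 1) ≤ Cz := by rw [hCz_def]; linarith only []
      exact mul_le_mul_of_nonneg_right hle hρz0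
    have key : ∀ G : ℝ, G * CN ≤ CN * Cη * (Real.sqrt (2 * Cmono) + Real.sqrt 2 * Cη + 1) * ρ ^ σz →
        G * CN * Real.sqrt X2 * Real.sqrt Y2 ≤ ηz * Real.sqrt X2 * Real.sqrt Y2 := by
      intro G hG
      rw [hηz]
      calc G * CN * Real.sqrt X2 * Real.sqrt Y2 = (G * CN) * (Real.sqrt X2 * Real.sqrt Y2) := by ring
        _ ≤ (CN * Cη * (Real.sqrt (2 * Cmono) + Real.sqrt 2 * Cη + 1) * ρ ^ σz) * (Real.sqrt X2 * Real.sqrt Y2) :=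
            mul_le_mul_of_nonneg_right hG hXY
        _ ≤ (Cz * ρ ^ σz) * (Real.sqrt X2 * Real.sqrt Y2) := mul_le_mul_of_nonneg_right hDle hXY
        _ = Cz * ρ ^ σz * Real.sqrt X2 * Real.sqrt Y2 := by ring
    exact hcomp.trans (key _ hglue)

end Summit.AnomalousDissipation.AnomalousDissipation.Theorems.SolenoidalFractalHomogenisation.LagrangianStep.Z7Glue

end
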